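import Mathlib
import Summits.HodgeConjecture.FermatCycles.HodgeFermatThreePointwiseA

/-!
# The row p = 3 of THEOREM L, step 2: the pointwise lemma at 3 — part 2: `pointwise₃` (`HodgeFermat/ThreePointwise.lean`; HF-G30b)

Tree copy (part 2 of 2) of the module `HodgeFermat/ThreePointwise.lean` of the sibling cell's standalone package
`run/shared/lean/pub/pub-hodgefermat/lean/HodgeFermat/` (460 lines, sha256 `48358d6edf25f8e6…`), source lines 212–460 (§§3–4: digits of units, the fibre step, `one_sided`, `lift_unit`, LEMMA P3 `pointwise₃`).
Filed by cell `pub-hfermat`, seat prover-1 gen-3, on the COORDINATOR KEEPER RULING of 2026-08-25 (gem sweep H1: take the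
off-gate kernel theorem `thmFstar` through the gate) — here THEOREM F* of `tables/DPRIME-THEOREM.md` §9 IN FULL, i.e.
PROPOSITION D′(3N) and the descent (`HodgeFermat/PropDPrimeNFinal.lean`, GATE HF-G34), the last off-gate form of THEOREM F*
(its first two forms, `DecodingFinal.thmFstar` = F* at the prime levels and `ThmFstarNFinal.thmFstar` = F*(3N), landed on
2026-08-25 as `HodgeFermatThmFstar.lean` / `HodgeFermatThmFstarN.lean`, seats prover-1 gen-0 / gen-2); this file is one link of
the import closure of `PropDPrimeNFinal.propDprime` (the sibling's KR-free chain: THEOREM L, COROLLARY M, THEOREM D6,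
THEOREM U⁺, THEOREM KR6, THEOREM Z3U) on top of those landed chains.  The source module is the sibling's hub-checked module of
record (pub-hodgefermat `CERT.md` l.960, GATE HF-G30b); its declarations are copied VERBATIM.
Deviations from the source module, exhaustively: the `import` lines (tree modules `Summits.HodgeConjecture.FermatCycles.
HodgeFermat*` instead of `HodgeFermat.*`); this module docstring; the `set_option`/namespace/`open` preamble (source l.22–26) is repeated at the top because the module is split. The module docstring is quoted in full in part 1.
Every other line — in particular every declaration's statement and proof — is byte-identical to the source.
HONEST FRAMING: explicit algebraic cycles for specific Hodge classes on Fermat/Delsarte varieties; residual open instances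
listed; no claim on general Hodge.  (This file is arithmetic of CM types / finite combinatorics / analytic number theory
of the sibling's KR-free programme; it claims nothing about cycles.)
-/

set_option autoImplicit false

namespace HodgeFermat.KRFree.ThreePointwise

open Finset HodgeFermat.KRFree.LemmaN HodgeFermat.KRFree.TheoremL HodgeFermat.KRFree.ThreeFibre

/-! ## (c) one-sided prime: the fibre argument -/

/-- digit `B` of the fibre over `t̄'` (at the entry `u`, `p ∤ u`) is realised by a unit lift unless
`p ∣ n'B + σ` -/
lemma digit_unit (p n' t' u B : ℕ) (hp : p.Prime) (_hpn : ¬ p ∣ n') (hn' : 0 < n') (hpu : ¬ p ∣ u)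
    (ht' : Nat.Coprime t' n') (hB : B < p) (hgood : ¬ p ∣ n' * B + t' * u % n') :
    ∃ j, Nat.Coprime (t' + j * n') (p * n') ∧ (t' + j * n') * u % (p * n') = n' * B + t' * u % n' := by
  have himg := liftB_image (t₀ := t') hp hn' hpu
  have hmem : B ∈ (range p).image (liftB p n' t' u) := by rw [himg]; exact mem_range.mpr hB
  obtain ⟨j, _, hjB⟩ := mem_image.mp hmem
  have hspec := (liftB_spec p n' t' u j hn' hp.pos).2
  rw [hjB] at hspec
  refine ⟨j, ?_, hspec⟩
  apply lift_coprime hp ht'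
  intro hd
  apply hgood
  have h1 : p ∣ (t' + j * n') * u := Dvd.dvd.mul_right hd u
  have h2 := Nat.div_add_mod ((t' + j * n') * u) (p * n')
  rw [hspec] at h2
  have h3 : p ∣ p * n' * ((t' + j * n') * u / (p * n')) :=
    Dvd.dvd.mul_right (Nat.dvd_mul_right p n') _
  have h4 : p ∣ p * n' * ((t' + j * n') * u / (p * n')) + (n' * B + t' * u % n') := by
    rw [h2]; exact h1
  exact (Nat.dvd_add_right h3).mp h4

/-- the `p`-divisible side is constant on the fibre -/
lemma vside (p n' t' j v' : ℕ) :
    (t' + j * n') * (p * v') % (p * n') = t' * (p * v') % (p * n') := by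
  have e : (t' + j * n') * (p * v') = t' * (p * v') + (j * v') * (p * n') := by ring
  rw [e, Nat.add_mul_mod_self_right]

/-- the bad digit is unique -/
lemma bad_unique {p n' σ B B' : ℕ} (hp : p.Prime) (hpn : ¬ p ∣ n') (_hB : B < p) (_hB' : B' < p)
    (h1 : p ∣ n' * B + σ) (h2 : p ∣ n' * B' + σ) : B = B' := by
  by_contra hne
  rcases Nat.lt_or_gt_of_ne hne with hlt | hlt
  · obtain ⟨d, rfl⟩ := Nat.exists_eq_add_of_lt hlt
    have e : n' * (B + d + 1) + σ = (n' * B + σ) + n' * (d + 1) := by ring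
    rw [e] at h2
    have h3 := (Nat.dvd_add_right h1).mp h2
    rcases (Nat.Prime.dvd_mul hp).mp h3 with h4 | h4
    · exact hpn h4
    · have := Nat.le_of_dvd (by omega) h4; omega
  · obtain ⟨d, rfl⟩ := Nat.exists_eq_add_of_lt hlt
    have e : n' * (B' + d + 1) + σ = (n' * B' + σ) + n' * (d + 1) := by ring
    rw [e] at h1
    have h3 := (Nat.dvd_add_right h2).mp h1
    rcases (Nat.Prime.dvd_mul hp).mp h3 with h4 | h4
    · exact hpn h4
    · have := Nat.le_of_dvd (by omega) h4; omega

/-- **the fibre step.**  On the fibre over the unit `t̄'` of `ℤ/n'` the hypothesis is contradictory unless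
`p = 5` and `σ = ⟨t' u⟩_{n'} ∈ M_{n'}`. -/
lemma fibre_step (p n' u v' t' : ℕ) (hp : p.Prime) (h5 : 5 ≤ p) (hpn : ¬ p ∣ n') (hn' : 0 < n')
    (h3 : ¬ 3 ∣ p * n') (hpu : ¬ p ∣ u) (ht' : Nat.Coprime t' n')
    (hM : ∀ t, Nat.Coprime t (p * n') →
      (Mid (p * n') (t * u % (p * n')) ↔ Mid (p * n') (t * (p * v') % (p * n')))) :
    p = 5 ∧ Mid n' (t' * u % n') := by
  obtain ⟨σ, hσ⟩ : ∃ s, t' * u % n' = s := ⟨_, rfl⟩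
  have hσn : σ < n' := by rw [← hσ]; exact Nat.mod_lt _ hn'
  -- every good digit has the Mid-value of the (constant) v-side
  have hgood : ∀ B, B < p → ¬ p ∣ n' * B + σ →
      (Mid (p * n') (n' * B + σ) ↔ Mid (p * n') (t' * (p * v') % (p * n'))) := by
    intro B hB hg
    rw [← hσ] at hg
    obtain ⟨j, hco, hres⟩ := digit_unit p n' t' u B hp hpn hn' hpu ht' hB hg
    have h := hM _ hco
    rw [hres, vside, hσ] at h
    exact h
  obtain ⟨P, hP⟩ : ∃ P, p * n' = P := ⟨_, rfl⟩
  have h5n : 5 * n' ≤ P := by rw [← hP]; exact Nat.mul_le_mul_right _ h5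
  have hPe : n' * (p - 1) + n' = P := by
    rw [← hP]; zify [hp.one_le]; ring
  rw [hP] at hgood
  -- digits 0 and p - 1 are outside
  have hout0 : ¬ Mid P (n' * 0 + σ) := by unfold Mid; omega
  have houtp : ¬ Mid P (n' * (p - 1) + σ) := by unfold Mid; omega
  -- hence the common value is `False`
  have hval : ¬ Mid P (t' * (p * v') % P) := by
    by_cases h0 : p ∣ n' * 0 + σ
    · have hg : ¬ p ∣ n' * (p - 1) + σ := by
        intro h
        have := bad_unique hp hpn hp.pos (by omega : p - 1 < p) h0 h
        omega
      rw [← hP]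
      exact fun hm => houtp ((hgood _ (by omega) hg).mpr (hP ▸ hm))
    · rw [← hP]
      exact fun hm => hout0 ((hgood _ hp.pos h0).mpr (hP ▸ hm))
  have hin : ∀ B, B < p → Mid P (n' * B + σ) → p ∣ n' * B + σ := by
    intro B hB hm
    by_contra hg
    exact hval ((hgood B hB hg).mp hm)
  -- the inside digit q + 1, q = ⌊(P − 3σ)/(3n')⌋
  obtain ⟨q, hq⟩ : ∃ q, (P - 3 * σ) / (3 * n') = q := ⟨_, rfl⟩
  have hq1 : 3 * n' * q ≤ P - 3 * σ := by rw [← hq]; exact Nat.mul_div_le _ _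
  have hq2 : P - 3 * σ < 3 * n' * q + 3 * n' := by
    rw [← hq]
    have := Nat.lt_div_mul_add (a := P - 3 * σ) (b := 3 * n') (by omega)
    linarith
  obtain ⟨Q, hQ⟩ : ∃ Q, n' * q = Q := ⟨_, rfl⟩
  have hQ3 : 3 * n' * q = 3 * Q := by rw [← hQ]; ring
  rw [hQ3] at hq1 hq2
  have e1 : n' * (q + 1) = Q + n' := by rw [Nat.mul_succ, hQ]
  have e2 : n' * (q + 2) = Q + 2 * n' := by rw [← hQ]; ring
  have hq1p : q + 1 < p := by
    have h : n' * (q + 1) < n' * p := by rw [e1, Nat.mul_comm n' p, hP]; omega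
    exact Nat.lt_of_mul_lt_mul_left h
  have hin1 : Mid P (n' * (q + 1) + σ) := by rw [e1]; unfold Mid; omega
  have hbad1 := hin (q + 1) hq1p hin1
  -- p ≥ 7 : the digit q + 2 is inside as well — contradiction
  by_cases h7 : 7 ≤ p
  · exfalso
    have h7n : 7 * n' ≤ P := by rw [← hP]; exact Nat.mul_le_mul_right _ h7
    have hq2p : q + 2 < p := by
      have h : n' * (q + 2) < n' * p := by rw [e2, Nat.mul_comm n' p, hP]; omega
      exact Nat.lt_of_mul_lt_mul_left h
    have hin2 : Mid P (n' * (q + 2) + σ) := by rw [e2]; unfold Mid; omega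
    have hbad2 := hin (q + 2) hq2p hin2
    have := bad_unique hp hpn hq1p hq2p hbad1 hbad2
    omega
  · -- p = 5
    have hp5 : p = 5 := by
      interval_cases p
      · rfl
      · exfalso; norm_num at hp
    subst hp5
    refine ⟨rfl, ?_⟩
    have hP5 : P = 5 * n' := hP.symm
    -- if the digit q + 2 were inside and < 5 it would be a second bad digit
    have hnot2 : ¬ (q + 2 < 5 ∧ Mid P (n' * (q + 2) + σ)) := by
      rintro ⟨hlt, hm⟩
      have hbad2 := hin (q + 2) hlt hm
      have := bad_unique hp hpn hq1p hlt hbad1 hbad2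
      omega
    rw [e2] at hnot2
    have h3n : ¬ 3 ∣ n' := by omega
    have hq4 : q < 4 := by omega
    unfold Mid at hnot2 ⊢
    interval_cases q <;> omega

/-- `p ∣ n`, `n` odd and prime to 3: `p ≥ 5` -/
lemma five_le {p n : ℕ} (hp : p.Prime) (hpn : p ∣ n) (hodd : Odd n) (h3 : ¬ 3 ∣ n) : 5 ≤ p := by
  have h2 := hp.two_le
  by_contra hlt; push Not at hlt
  interval_cases p
  · obtain ⟨k, hk⟩ := hodd
    omega
  · exact h3 hpn
  · norm_num at hp

/-- **(c)** a prime dividing exactly one of the two entries is impossible -/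
lemma one_sided (p n' u v' : ℕ) (hp : p.Prime) (h5 : 5 ≤ p) (hpn : ¬ p ∣ n') (hn' : 0 < n')
    (hodd : Odd n') (h3 : ¬ 3 ∣ p * n') (hpu : ¬ p ∣ u)
    (hM : ∀ t, Nat.Coprime t (p * n') →
      (Mid (p * n') (t * u % (p * n')) ↔ Mid (p * n') (t * (p * v') % (p * n')))) : False := by
  obtain ⟨hp5, h1⟩ := fibre_step p n' u v' 1 hp h5 hpn hn' h3 hpu (Nat.coprime_one_left n') hM
  obtain ⟨-, h2⟩ := fibre_step p n' u v' 2 hp h5 hpn hn' h3 hpu (Nat.coprime_two_left.mpr hodd) hM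
  rw [one_mul] at h1
  have e : 2 * u % n' + n' * (2 * (u % n') / n') = 2 * (u % n') := by
    have h := (Nat.mod_modEq u n').mul_left 2
    unfold Nat.ModEq at h
    have hd := Nat.mod_add_div (2 * (u % n')) n'
    rw [h] at hd
    exact hd
  have hσ : u % n' < n' := Nat.mod_lt _ hn'
  obtain ⟨k, hk⟩ : ∃ k, 2 * (u % n') / n' = k := ⟨_, rfl⟩
  have hk2 : k < 2 := by rw [← hk]; exact (Nat.div_lt_iff_lt_mul hn').mpr (by omega)
  rw [hk] at e
  unfold Mid at h1 h2
  interval_cases k <;> omega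

/-! ## (b) pulling back along a common prime, and the induction -/

/-- units of `ℤ/n'` lift to units of `ℤ/(p n')` (`p`, `n'` coprime) -/
lemma lift_unit {p n' : ℕ} (hco : Nat.Coprime p n') (t' : ℕ) (ht' : Nat.Coprime t' n') :
    ∃ t, Nat.Coprime t (p * n') ∧ t ≡ t' [MOD n'] := by
  obtain ⟨k, hk1, hk2⟩ := Nat.chineseRemainder hco.symm t' 1
  refine ⟨k, Nat.Coprime.mul_right ?_ ?_, hk1⟩
  · have hk1' : Nat.gcd k p = Nat.gcd 1 p := Nat.ModEq.gcd_eq hk2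
    unfold Nat.Coprime; rw [hk1']; exact Nat.gcd_one_left p
  · unfold Nat.Coprime; rw [Nat.ModEq.gcd_eq hk1]; exact ht'

/-- **LEMMA P3 (pointwise lemma at 3).** -/
theorem pointwise₃ : ∀ n u v : ℕ, Squarefree n → Odd n → ¬ 3 ∣ n → ¬ n ∣ u → ¬ n ∣ v →
    (∀ t, Nat.Coprime t n → (Mid n (t * u % n) ↔ Mid n (t * v % n))) →
    (u ≡ v [MOD n] ∨ n ∣ u + v) := by
  intro n
  induction n using Nat.strong_induction_on with
  | _ n ih =>
  intro u v hsq hodd h3n hu hv hM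
  have hn1 : n ≠ 1 := fun h => hu (h ▸ Nat.one_dvd u)
  have hn5 : 5 ≤ n := by
    obtain ⟨k, hk⟩ := hodd
    omega
  have hn0 : 0 < n := by omega
  by_cases hcu : Nat.Coprime u n
  · by_cases hcv : Nat.Coprime v n
    · exact unit_case n u v hn5 hodd h3n hcu hcv hM
    · exfalso
      obtain ⟨p, hp, hpv, hpn⟩ := Nat.Prime.not_coprime_iff_dvd.mp hcv
      have hpu : ¬ p ∣ u :=
        (Nat.Prime.coprime_iff_not_dvd hp).mp (Nat.Coprime.coprime_dvd_right hpn hcu).symm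
      obtain ⟨n', rfl⟩ := hpn
      obtain ⟨v', rfl⟩ := hpv
      have hsq' := Nat.squarefree_mul_iff.mp hsq
      have hpn' : ¬ p ∣ n' := (Nat.Prime.coprime_iff_not_dvd hp).mp hsq'.1
      exact one_sided p n' u v' hp (five_le hp (Nat.dvd_mul_right p n') hodd h3n) hpn'
        (Nat.pos_of_ne_zero (by rintro rfl; simp at hn0)) (Nat.Odd.of_mul_right hodd) h3n hpu hM
  · obtain ⟨p, hp, hpu, hpn⟩ := Nat.Prime.not_coprime_iff_dvd.mp hcu
    obtain ⟨n', rfl⟩ := hpn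
    obtain ⟨u', rfl⟩ := hpu
    have hsq' := Nat.squarefree_mul_iff.mp hsq
    have hpn' : ¬ p ∣ n' := (Nat.Prime.coprime_iff_not_dvd hp).mp hsq'.1
    have hn' : 0 < n' := Nat.pos_of_ne_zero (by rintro rfl; simp at hn0)
    have hodd' : Odd n' := Nat.Odd.of_mul_right hodd
    have h5 := five_le hp (Nat.dvd_mul_right p n') hodd h3n
    by_cases hpv : p ∣ v
    · -- (b): pull back to level n'
      obtain ⟨v', rfl⟩ := hpv
      have h3n' : ¬ 3 ∣ n' := fun h => h3n (Dvd.dvd.mul_left h p)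
      have hu' : ¬ n' ∣ u' := fun h => hu (Nat.mul_dvd_mul_left p h)
      have hv' : ¬ n' ∣ v' := fun h => hv (Nat.mul_dvd_mul_left p h)
      have hM' : ∀ t, Nat.Coprime t n' → (Mid n' (t * u' % n') ↔ Mid n' (t * v' % n')) := by
        intro t' ht'
        obtain ⟨t, htco, htt'⟩ := lift_unit hsq'.1 t' ht'
        have h := hM t htco
        have e1 : t * (p * u') % (p * n') = p * (t * u' % n') := by
          rw [show t * (p * u') = p * (t * u') by ring, Nat.mul_mod_mul_left]
        have e2 : t * (p * v') % (p * n') = p * (t * v' % n') := by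
          rw [show t * (p * v') = p * (t * v') by ring, Nat.mul_mod_mul_left]
        rw [e1, e2, mid_mul p n' _ hp.pos, mid_mul p n' _ hp.pos] at h
        have f1 : t * u' % n' = t' * u' % n' := (htt'.mul_right u')
        have f2 : t * v' % n' = t' * v' % n' := (htt'.mul_right v')
        rw [f1, f2] at h
        exact h
      have hlt : n' < p * n' := by nlinarith [hp.two_le]
      rcases ih n' hlt u' v' hsq'.2.2 hodd' h3n' hu' hv' hM' with h | h
      · left; exact Nat.ModEq.mul_left' p h
      · right
        rw [← Nat.mul_add]
        exact Nat.mul_dvd_mul_left p h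
    · -- (c) with the roles of u, v exchanged
      exfalso
      have hM'' : ∀ t, Nat.Coprime t (p * n') →
          (Mid (p * n') (t * v % (p * n')) ↔ Mid (p * n') (t * (p * u') % (p * n'))) :=
        fun t ht => (hM t ht).symm
      exact one_sided p n' v u' hp h5 hpn' hn' hodd' h3n hpv hM''

end HodgeFermat.KRFree.ThreePointwise
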